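import Summits.QuantumFields.YangMills.Theorems.BalabanUVNodesN13UVRowRFreeAtLiveSelectorRecord13
import Summits.QuantumFields.YangMills.Theorems.BalabanUVNodesN13UVChiOffSolvableAtRecord13
import Summits.QuantumFields.YangMills.Theses.BalabanUVNodes

/-!
# BalabanUVNodes ∕ N13 — LOCATED KERNEL CERTIFICATE: THE LOWER HALF OF [III] Cor. 3 (2.50) ∕ [B16] (0.1) AT ANY LEVEL `k+1 ≥ 1` OF NODE 00's STAGE-13 RECORD,
# AS TYPED (at EVERY field), PINS A POINT VALUE OF THE MARGINAL-DENSITY VERSION OF RECORD — for EVERY parameter `θ`; hence so does K1⁷'s (B) conjunct, and the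
# crux `StabilityBAtRecordR13SepCoPH` itself entails such a point value for every family carrying K0⁷'s conclusion

Cell `pub-ymgap` (HUMAN RULING D-0062 Track A ∕ D-0149 width), WIDTH SEAT `pub-ymgap-dag-n13-w1` (gen 4, CLAIM-3), key K1⁷ `StabilityBAtRecordR13SepCoPH` =
stmt-QuantumFields-20542 (`--kind proof --supports … --as helper`; count-neutral; LOCATED reading for plan ∕ CRIT-1 ∕ dag-lead — NO re-cut asked by this seat).
[III] = [Balaban1988Convergent], [B16] = [Balaban1989LargeFieldII], [I] = [Balaban1987RG1].

WHAT.  By def-T's (†) (`Node00.texpASucc_apply`; this seat's p607786 §5) the level-`(k+1)` PRE-𝐑 slot of record is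
`slotT_{k+1}(s′)(V′) = avgDensity_k(V′) · ∫ (w·χ_k·slot_k)(init s′) ∂avgKernel_k(V′)`, where `avgDensity_k = T4AveragingDisintegration.margDensity (dU_k) (dV_{k+1}) Ū
= rnNN …` is `(Measure.rnDeriv ((dU_k).map Ū) (dV_{k+1}) ·).toNNReal` — Mathlib's CHOSEN version (`Measure.rnDeriv` is `Classical.choose` of the Lebesgue decomposition;
the tree's knowledge of it is `dV`-a.e.: `T4AveragingDisintegration.withDensity_margDensity`, `avgKernel_fibre_ae`).  The post-𝐑 slot is the pre-𝐑 slot times (0.3) ratios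
(`Node00.rstepOfSel_TexpA`), for ANY selector.  Hence (§1, for EVERY `θ : Stage13Params`, no selector clause, no ζ-law): **where `avgDensity_k(V′) = 0`, every pre-𝐑
slot, every post-𝐑 slot and the density `ρ_{k+1}(V′)` of record VANISH**; contrapositively `0 < ρ_{k+1}(V′) ⇒ avgDensity_k(V′) ≠ 0`.  (§2) the (2.9) cut-off of record is
`1` at the configuration `V₁ := critCfgOfRecord ν K (k+1) 1` (the critical configuration over the UNIT coarse field; both branches of def-B's `Uk`: on the solvable branch
`M(V₁) = 1` by `Node00.avg_critCfgOfRecord`, on the junk branch `V₁ = M^{k+1}(1)` and `M(1) = 1`), because every fluctuation variable `|V₁(b)·V^{(k+1)}(M V₁)(b)⁻¹ − 1|`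
is `dist1 1 = 0 < ε₂₉`.  So (§3) the LOWER inequality of (2.50)∕(0.1) at `(P, k+1, V₁)` — `χβ_{k+1}(V₁)·exp(−g⁻²A − e₋|T|) ≤ ρ_{k+1}(V₁)` with `χβ_{k+1}(V₁) = 1` — forces
`ρ_{k+1}(V₁) > 0`, i.e. **`avgDensity (avOfRecord F N P.K k).avg V₁ ≠ 0`**: `B16.Cor3With (datumOfRecord₁₃SepCoPH θ h).C γ em ep` at any windowed run with `k+1 ≤ K`
pins this point value (`avgDensity_critCfg_one_ne_zero_of_cor3With_datum`); K1⁷'s consequent at `θ` ((B) ∧ the `K ≥ 1` window) pins it at level 1 of some run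
(`…_of_endStatementBPrinted_of_window`); and (§4) the crux decl `Summit.QuantumFields.YangMills.Theses.BalabanUVNodes.StabilityBAtRecordR13SepCoPH` entails, for
EVERY family `F` with K0⁷'s conclusion, SOME `θ` and windowed run `P` with `avgDensity (avOfRecord F 2 P.K 0).avg (critCfgOfRecord θ.ν P.K 1 1) ≠ 0`
(`exists_avgDensity_ne_zero_of_stabilityBAtRecordR13SepCoPH`).

READING (prose; a kernel theorem cannot state provability).  The pinned statement is the non-vanishing AT ONE POINT of a function specified only up to `dV₁`-null sets
(`Measure.haveLebesgueDecomposition_spec` is invariant under modifying the density on a null measurable set; at `N = 2` singletons of `GaugeField … (SU 2)` are null for the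
product Haar measure).  So the (B) conjunct of K1⁷ AS TYPED — (2.50) at EVERY `V` on `densOfRecord₁₃`, whose levels `≥ 1` are built from the chosen version — is, at every
`θ`, a statement about the CHOICE of version, not only about Bałaban's estimates; the version-free currencies of (2.50) (`dV`-a.e.; as inequalities of measures; after
integration — what the rung's (G2)∕(G5) socket reads, this seat's g3 `…StabilitySocketOfTopLevelLower…`) are the ones an estimate can reach.  This is the K1⁷ ∕ Stage-13 ∕
v6 instance of readings already on the record for other slots: dag-n13-b TS-4 (INBOX l.9746, Stage 7, `rnTransport`), node00-def-T ERRATUM-VERSION (l.11075: «POINTWISE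
DETERMINACY ✗ … `margDensity = rnNN`»), dag-ref-D RIDER №6 (b), dag-n23-b (H-h) (l.11265), dag-ref-C READ185 AUDIT A2 (N08's slot re-pointed to `PrintedUV3V`).  LOCATED;
count-neutral; the planners decide what, if anything, follows.

CONTENTS (theorems only; 0 `def`).  §1 `slotsTOfRecord_succ_eq_zero_of_avgDensity_eq_zero` · `rstepOfSel_TexpA_eq_zero_of_TexpA_eq_zero` · `rstepSlot_eq_zero_of_apply_eq_zero` · `slotsOfRecord_succ_eq_zero_of_avgDensity_eq_zero`
· ★ `densOfRecord₁₃_succ_eq_zero_of_avgDensity_eq_zero` · `avgDensity_ne_zero_of_densOfRecord₁₃_succ_pos`.  §2 `avg_critCfgOfRecord_one` · ★ `chiFix29OfRecord_critCfgOfRecord_one`.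
§3 `succ_succ_le_m_add_K` · ★ `avgDensity_critCfg_one_ne_zero_of_uvLower₁₃_succ` (the engines' `hUV` letters) · ★★ `avgDensity_critCfg_one_ne_zero_of_cor3With_datum` · ★★
`exists_avgDensity_ne_zero_of_endStatementBPrinted_of_window`.  §4 ★★★
`exists_avgDensity_ne_zero_of_stabilityBAtRecordR13SepCoPH`.

HONEST FRAMING.  Count-neutral kernel bookkeeping (unfolding def-T's (†), def-R's (0.3), def-χ's (2.9), def-B's two branches); nothing of Bałaban's asserted or refuted;
K1⁷ neither proved nor refuted here (the theorems are implications FROM its consequent ∕ from the decl); N13 NOT discharged; no stub closed; counts unmoved (typed 28∕28 ·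
discharged 5∕27, A 5∕28); one finite `𝕋⁴_{L^K}` programme at fixed `ε = L^{−K}`; route R4 closes the CONDITIONAL finite-𝕋⁴ rung `BalabanLadder.UV` only — the Yang–Mills mass
gap (Clay) is NOT proved by any of this.  No `sorry`, `def`, `instance`, `notation`; standard axioms.
-/

noncomputable section

open scoped BigOperators Matrix.Norms.L2Operator

namespace Summit.QuantumFields.YangMills.BalabanUVNodes.N13Cor3PinsMargDensityVersionAtRecord13

open MeasureTheory
open Literature.MathematicalPhysics.QuantumFieldTheory.Balaban1983to89
open Literature.MathematicalPhysics.QuantumFieldTheory.Balaban1983to89.T4Continuum (T4Family)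
open Literature.MathematicalPhysics.QuantumFieldTheory.Balaban1983to89.Node00
open B14.Eq218Concrete
open T4AveragingDisintegration (avgDensity avgKernel)
open Summit.QuantumFields.YangMills.BalabanUVNodes.N13UVChiOffSolvableAtRecord13 (iter_avOfRecord_one)

variable {F : T4Family} {N : ℕ} [NeZero N]

/-! ## §1 WHERE THE MARGINAL-DENSITY VERSION VANISHES, EVERY LEVEL-`(k+1)` OBJECT OF RECORD VANISHES (any `θ`, any selector, no ζ-law) -/

section Vanishing

variable (θ : Stage13Params F N) (P : B12.RunParams) (k : ℕ)

/-- **The pre-𝐑 slot of record at level `k+1` vanishes where `avgDensity_k` does** (def-T's (†): `slotT_{k+1}(s′)(V′) = avgDensity_k(V′)·∫…`).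
[cite: Balaban1988Convergent, (3.1) p.264, (3.24)–(3.25) p.270 (bookkeeping over def-T's definition)] -/
theorem slotsTOfRecord_succ_eq_zero_of_avgDensity_eq_zero {V' : GaugeField (F.P P.K) (k + 1) (SU N)} (h0 : avgDensity (avOfRecord F N P.K k).avg V' = 0)
    (s' : SeqOfRecord F θ.ν θ.τ9.M (gOfRecord₁₃ F N θ P) P.K (k + 1)) :
    slotsTOfRecord F N θ.ν θ.τ9 (EOfRecord₁₃ F N θ) (wOfRecord₉ F N θ.toStage9Params) θ.ppSel P (gOfRecord₁₃ F N θ P) (k + 1) s' V' = 0 := by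
  rw [slotsTOfRecord_succ]
  unfold tstepOfRecord
  rw [texpASucc_apply, h0, NNReal.coe_zero, zero_mul]

/-- **(0.3) re-indexed kills a slot value that is already zero** (generic over def-R's `Step.Repr218`; `(𝐑_sel)(a′)(V) = (𝐓e^A)(a′)(V)·Σ(ratios)`, def-R's
`rstepOfSel_TexpA`).  The `DecidableEq (PBond …)` instance is an implicit binder, met by unification (def-R's instance-free terms; K0a's TS-8 convention).
[cite: Balaban1989LargeFieldI, (0.3) p.176 (bookkeeping)] -/
theorem rstepOfSel_TexpA_eq_zero_of_TexpA_eq_zero {P : Params} {G : Type*} [GaugeGroup G] [MeasurableSpace G] [HaarData G] {j : ℕ}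
    {iP : DecidableEq (PBond P j)} (r : Step.Repr218 P G j) (sel : r.Adm → r.Adm) (fib : r.Adm → Finset (PBond P j)) {a' : r.Adm}
    {V : GaugeField P j G} (h0 : r.TexpA a' V = 0) : (rstepOfSel r sel fib).TexpA a' V = 0 := by
  rw [rstepOfSel_TexpA, h0, zero_mul]

/-- **The 𝐑-step of record of ANY selector kills a slot value that is already zero.** [cite: Balaban1989LargeFieldI, (0.3) p.176 (bookkeeping)] -/
theorem rstepSlot_eq_zero_of_apply_eq_zero {ν : Stage7Numerics} {τ : TowerNumerics} {p : B12.RunParams} {g : ℕ → ℝ} {j : ℕ}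
    (sel : SeqOfRecord F ν τ.M g p.K j → SeqOfRecord F ν τ.M g p.K j) (f : TexpASlot F N ν τ.M p g j) {s : SeqOfRecord F ν τ.M g p.K j}
    {V : GaugeField (F.P p.K) j (SU N)} (hf : f s V = 0) : rstepSlot F N ν τ p g j sel f s V = 0 := by
  unfold rstepSlot
  exact rstepOfSel_TexpA_eq_zero_of_TexpA_eq_zero (sliceOfRecord F N ν τ.M p g j f) sel (fibOfSeq F ν τ p g j) hf

/-- **The post-𝐑 slot of record at level `k+1` vanishes where `avgDensity_k` does** (any selector). [cite: Balaban1989LargeFieldI, (0.3) p.176; Balaban1988Convergent, (3.24)–(3.25) p.270 (bookkeeping)] -/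
theorem slotsOfRecord_succ_eq_zero_of_avgDensity_eq_zero {V' : GaugeField (F.P P.K) (k + 1) (SU N)} (h0 : avgDensity (avOfRecord F N P.K k).avg V' = 0)
    (s' : SeqOfRecord F θ.ν θ.τ9.M (gOfRecord₁₃ F N θ P) P.K (k + 1)) :
    slotsOfRecord F N θ.ν θ.τ9 (EOfRecord₁₃ F N θ) (wOfRecord₉ F N θ.toStage9Params) θ.ppSel P (gOfRecord₁₃ F N θ P) (k + 1) s' V' = 0 := by
  rw [slotsOfRecord_succ]
  exact rstepSlot_eq_zero_of_apply_eq_zero _ _ (slotsTOfRecord_succ_eq_zero_of_avgDensity_eq_zero θ P k h0 s')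

/-- **★ THE DENSITY OF RECORD `ρ_{k+1}` VANISHES WHERE `avgDensity_k` DOES** — for EVERY Stage-13 parameter (no selector clause, no ζ-law): `ρ_{k+1} = Σ_s χ_{k+1}(s)·slot_{k+1}(s)`.
[cite: Balaban1988Convergent, (2.18) p.257, (3.1) p.264, (3.24)–(3.25) p.270; Balaban1989LargeFieldI, (0.2)–(0.3) p.176 (bookkeeping)] -/
theorem densOfRecord₁₃_succ_eq_zero_of_avgDensity_eq_zero {V' : GaugeField (F.P P.K) (k + 1) (SU N)} (h0 : avgDensity (avOfRecord F N P.K k).avg V' = 0) :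
    densOfRecord₁₃ F N θ P (k + 1) V' = 0 := by
  show ∑ s, _ = (0 : ℝ)
  exact Finset.sum_eq_zero fun s _ => by rw [slotsOfRecord_succ_eq_zero_of_avgDensity_eq_zero θ P k h0 s, mul_zero]

/-- **Contrapositive: a POSITIVE value of `ρ_{k+1}` at `V′` pins `avgDensity_k(V′) ≠ 0`.** [cite: Balaban1988Convergent, (2.18) p.257, (3.1) p.264 (bookkeeping)] -/
theorem avgDensity_ne_zero_of_densOfRecord₁₃_succ_pos {V' : GaugeField (F.P P.K) (k + 1) (SU N)} (hpos : 0 < densOfRecord₁₃ F N θ P (k + 1) V') :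
    avgDensity (avOfRecord F N P.K k).avg V' ≠ 0 :=
  fun h0 => (ne_of_gt hpos) (densOfRecord₁₃_succ_eq_zero_of_avgDensity_eq_zero θ P k h0)

end Vanishing

/-! ## §2 THE (2.9) CUT-OFF OF RECORD IS `1` AT THE CRITICAL CONFIGURATION OVER THE UNIT COARSE FIELD (both branches of def-B's `Uk`) -/

section Chi

variable (ν : Stage7Numerics) (K j : ℕ)

/-- **`M(V^{(j)}(1)) = 1` on BOTH branches**: on the solvable branch by `Node00.avg_critCfgOfRecord`; on the junk branch `V^{(j)}(1) = M^j(1)` (`critCfgOfRecord_of_not`) and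
`M^{j+1}(1) = 1` (`iter_avOfRecord_one`, `j + 1 ≤ m + K`). [cite: Balaban1987RG1, (2.3) p.265, (0.4) p.253 (bookkeeping)] -/
theorem avg_critCfgOfRecord_one (hj : j + 1 ≤ (F.P K).m + (F.P K).K) :
    (avOfRecord F N K j).avg (critCfgOfRecord F N ν K j 1) = 1 := by
  by_cases h : UkExists F N K (j + 1) ν.εreg (1 : GaugeField (F.P K) (j + 1) (SU N))
  · exact avg_critCfgOfRecord h
  · rw [critCfgOfRecord_of_not h]
    exact iter_avOfRecord_one (F := F) (N := N) hj

/-- **★ `χ^{(2.9)}_j(V₁) = 1` AT `V₁ := V^{(j)}(1)`** (the critical configuration over the UNIT coarse field), for every threshold `ε₁ > 0`: every fluctuation variable of `V₁` is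
`dist1 (V₁(b)⁻¹·V₁(b)) = dist1 1 = 0`, because the critical configuration over `M(V₁) = 1` is `V₁` itself (§2's `avg_critCfgOfRecord_one`).  A hypothesis-free INHABITANT of the
support of the β-slot cut-off of record. [cite: Balaban1987RG1, (2.9) p.266, (2.3) p.265 (bookkeeping)] -/
theorem chiFix29OfRecord_critCfgOfRecord_one {ε₁ : ℝ} (hε : 0 < ε₁) (hj : j + 1 ≤ (F.P K).m + (F.P K).K) :
    chiFix29OfRecord F N ν ε₁ K j (critCfgOfRecord F N ν K j 1) = 1 := by
  rw [chiFix29OfRecord_eq_one_iff]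
  intro b _
  rw [fluctDevOfRecord_apply, avg_critCfgOfRecord_one ν K j hj, inv_mul_cancel, GaugeGroup.dist1_one]
  exact hε

end Chi

/-! ## §3 (2.50)'s LOWER HALF AT THE DATUM OF RECORD PINS `avgDensity ≠ 0` AT A POINT; so does K1⁷'s consequent -/

section Datum

variable (θ : Stage13HParams F N) (h : θ.Provisos₁₃SepCoPH F N)

/-- Level bookkeeping: `k + 1 ≤ P.K ⇒ (k+1) + 1 ≤ m + K` on the torus of the run (`m ≥ 1`). [cite: Balaban1987RG1, (0.1) p.251 (bookkeeping)] -/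
theorem succ_succ_le_m_add_K {P : B12.RunParams} {k : ℕ} (hk : k + 1 ≤ P.K) : k + 1 + 1 ≤ (F.P P.K).m + (F.P P.K).K := by
  have hm := F.hm
  rw [T4Family.P_K, T4Family.P_m]
  omega

/-- **★ THE LOWER INEQUALITY OF (UV₁₃) IN THE ENGINES' `hUV` LETTERS (stub 1's N13 child, dag-n24-c's 30H∕34H) AT `(P, k+1, V₁)` PINS THE VERSION**: for EVERY
`θ : Stage13Params` with `0 < ε₂₉` and any number `em`, `χβ_{k+1}(V₁)·exp(−g_{k+1}⁻²A^η_{k+1}(V₁) − em·|T₁^{(k+1)}|) ≤ ρ_{k+1}(V₁)` at `V₁ = critCfgOfRecord θ.ν P.K (k+1) 1` gives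
`avgDensity (avOfRecord F N P.K k).avg V₁ ≠ 0` (`χβ_{k+1}(V₁) = 1`, §2; `ρ_{k+1}(V₁) > 0`; §1). [cite: Balaban1989LargeFieldII, (0.1) pp.355–356; Balaban1988Convergent, Cor. 3 (2.50) p.264, (3.1) p.264; Balaban1987RG1, (2.9) p.266 (bookkeeping)] -/
theorem avgDensity_critCfg_one_ne_zero_of_uvLower₁₃_succ (θ₀ : Stage13Params F N) (hε' : 0 < θ₀.ε₂₉) (P : B12.RunParams) (k : ℕ) (hk : k + 1 ≤ P.K) (em : ℝ)
    (hL : chiβOfRecord₁₃ F N θ₀ P.K (gOfRecord₁₃ F N θ₀ P) (k + 1) (critCfgOfRecord F N θ₀.ν P.K (k + 1) 1) *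
        Real.exp (-(1 / (gOfRecord₁₃ F N θ₀ P (k + 1)) ^ 2 * wilsonBGOfRecord F N θ₀.εbg P (k + 1) (critCfgOfRecord F N θ₀.ν P.K (k + 1) 1))
          - em * (Fintype.card (Site (F.P P.K) (k + 1)) : ℝ)) ≤
      densOfRecord₁₃ F N θ₀ P (k + 1) (critCfgOfRecord F N θ₀.ν P.K (k + 1) 1)) :
    avgDensity (avOfRecord F N P.K k).avg (critCfgOfRecord F N θ₀.ν P.K (k + 1) 1) ≠ 0 := by
  have hχ : chiβOfRecord₁₃ F N θ₀ P.K (gOfRecord₁₃ F N θ₀ P) (k + 1) (critCfgOfRecord F N θ₀.ν P.K (k + 1) 1) = 1 :=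
    chiFix29OfRecord_critCfgOfRecord_one θ₀.ν P.K (k + 1) hε' (succ_succ_le_m_add_K hk)
  rw [hχ, one_mul] at hL
  exact avgDensity_ne_zero_of_densOfRecord₁₃_succ_pos θ₀ P k ((Real.exp_pos _).trans_le hL)

/-- **★★ [III] Cor. 3's (2.50) AT NODE 00's STAGE-13 DATUM OF RECORD, AS TYPED, PINS A POINT VALUE OF THE VERSION**: `B16.Cor3With (datumOfRecord₁₃SepCoPH θ h).C γ em ep`
(for ANY admissible-threshold `θ`, any `γ em ep`), a run in the `γ`-window and a level `k + 1 ≤ K` give `avgDensity (avOfRecord F N P.K k).avg V₁ ≠ 0` at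
`V₁ = critCfgOfRecord θ.ν P.K (k+1) 1`.  PROOF: the lower inequality at `(P, k+1, V₁)` reads `1·exp(…) ≤ ρ_{k+1}(V₁)` (§2), so `ρ_{k+1}(V₁) > 0`, so §1.
[cite: Balaban1988Convergent, Cor. 3 (2.50) p.264, (2.18) p.257, (3.1) p.264; Balaban1989LargeFieldII, (0.1) pp.355–356; Balaban1987RG1, (2.9) p.266 (bookkeeping)] -/
theorem avgDensity_critCfg_one_ne_zero_of_cor3With_datum (hε' : 0 < θ.ε₂₉) {γ : ℝ} {em ep : ℝ → ℝ}
    (hcor : B16.Cor3With (datumOfRecord₁₃SepCoPH F N θ h).C γ em ep) (P : B12.RunParams)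
    (hP : ((datumOfRecord₁₃SepCoPH F N θ h).C P).flow.InInterval γ P.K) (k : ℕ) (hk : k + 1 ≤ P.K) :
    avgDensity (avOfRecord F N P.K k).avg (critCfgOfRecord F N θ.ν P.K (k + 1) 1) ≠ 0 := by
  set V₁ : GaugeField (F.P P.K) (k + 1) (SU N) := critCfgOfRecord F N θ.ν P.K (k + 1) 1 with hV₁
  obtain ⟨hlow, -⟩ := hcor P hP (k + 1) hk V₁
  have hχ : ((datumOfRecord₁₃SepCoPH F N θ h).C P).χ (k + 1) V₁ = 1 :=
    chiFix29OfRecord_critCfgOfRecord_one θ.ν P.K (k + 1) hε' (succ_succ_le_m_add_K hk)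
  rw [hχ, one_mul] at hlow
  have hpos : 0 < densOfRecord₁₃ F N θ.toStage13Params P (k + 1) V₁ := (Real.exp_pos _).trans_le hlow
  exact avgDensity_ne_zero_of_densOfRecord₁₃_succ_pos θ.toStage13Params P k hpos

/-- **★★ K1⁷'s CONSEQUENT AT `θ` — (B) ∧ THE `K ≥ 1` WINDOW — PINS A POINT VALUE OF THE VERSION AT LEVEL 1 OF SOME WINDOWED RUN**: from `B16.EndStatementBPrinted (datum).C`
(its Cor-3 half gives `γ′, em, ep`) and the window clause (a run with `1 ≤ K` in the `min γ₁ γ′`-window), §3 at `k = 0`.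
[cite: Balaban1989LargeFieldII, Thm 1 p.355, (0.1) pp.355–356; Balaban1988Convergent, Cor. 3 (2.50) p.264; Balaban1987RG1, (0.17)–(0.20) pp.255–256 (bookkeeping)] -/
theorem exists_avgDensity_ne_zero_of_endStatementBPrinted_of_window (hε' : 0 < θ.ε₂₉)
    (hB : B16.EndStatementBPrinted (datumOfRecord₁₃SepCoPH F N θ h).C)
    (hW : ∃ γ₁ : ℝ, 0 < γ₁ ∧ ∀ γ : ℝ, 0 < γ → γ ≤ γ₁ → ∃ P : B12.RunParams, 1 ≤ P.K ∧ ((datumOfRecord₁₃SepCoPH F N θ h).C P).flow.InInterval γ P.K) :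
    ∃ P : B12.RunParams, 1 ≤ P.K ∧ avgDensity (avOfRecord F N P.K 0).avg (critCfgOfRecord F N θ.ν P.K 1 1) ≠ 0 := by
  obtain ⟨γ', hγ', em, ep, hcor⟩ := hB.2
  obtain ⟨γ₁, hγ₁, hwin⟩ := hW
  obtain ⟨P, hK, hI⟩ := hwin (min γ₁ γ') (lt_min hγ₁ hγ') (min_le_left _ _)
  have hI' : ((datumOfRecord₁₃SepCoPH F N θ h).C P).flow.InInterval γ' P.K :=
    fun j hj => ⟨(hI j hj).1, (hI j hj).2.trans (min_le_right _ _)⟩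
  exact ⟨P, hK, avgDensity_critCfg_one_ne_zero_of_cor3With_datum θ h hε' hcor P hI' 0 hK⟩

end Datum

/-! ## §4 THE CRUX DECL ITSELF ENTAILS SUCH A POINT VALUE FOR EVERY FAMILY CARRYING K0⁷'s CONCLUSION -/

section Crux

/-- **★★★ LOCATED: `StabilityBAtRecordR13SepCoPH` (K1⁷, stmt-QuantumFields-20542) ⟹ for every family `F` with K0⁷'s conclusion (an admissible Stage-13 tuple with provisos, unity,
slot non-degeneracy) there are a parameter `θ` and a windowed run `P` (`K ≥ 1`) with `avgDensity (avOfRecord F 2 P.K 0).avg (critCfgOfRecord θ.ν P.K 1 1) ≠ 0`** — the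
non-vanishing AT ONE POINT of `rnNN ((dU_0).map Ū) dV_1`, Mathlib's chosen `Measure.rnDeriv` version of the marginal density of Bałaban's first block average, which the tree
knows only `dV_1`-a.e.  An implication FROM the crux; K1⁷ is neither proved nor refuted here.  READING: see the module docstring.
[cite: Balaban1989LargeFieldII, Thm 1 p.355, (0.1) pp.355–356; Balaban1988Convergent, Cor. 3 (2.50) p.264, (3.1) p.264; Balaban1987RG1, (2.9) p.266 (bookkeeping)] -/
theorem exists_avgDensity_ne_zero_of_stabilityBAtRecordR13SepCoPH
    (hK1 : Summit.QuantumFields.YangMills.Theses.BalabanUVNodes.StabilityBAtRecordR13SepCoPH) (F : T4Family)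
    (hK0 : ∃ θ : Stage13HParams F 2, θ.Provisos₁₃SepCoPH F 2 ∧ (θ.ZhUnity F 2 ∧ θ.SlotsNondegenerate₁₃ F 2) ∧ θ.Admissible F 2) :
    ∃ (θ : Stage13HParams F 2) (P : B12.RunParams), 1 ≤ P.K ∧ avgDensity (avOfRecord F 2 P.K 0).avg (critCfgOfRecord F 2 θ.ν P.K 1 1) ≠ 0 := by
  obtain ⟨θ, h, -, hθ, hB, hW⟩ := hK1 F hK0
  obtain ⟨P, hK, hne⟩ := exists_avgDensity_ne_zero_of_endStatementBPrinted_of_window θ h hθ.ε₂₉_pos hB hW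
  exact ⟨θ, P, hK, hne⟩

end Crux

end Summit.QuantumFields.YangMills.BalabanUVNodes.N13Cor3PinsMargDensityVersionAtRecord13

end
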